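import Literature.NumberTheory.Automorphic.OrbitalEulerProductModel
import Literature.NumberTheory.Automorphic.UnitaryGroupPureTensorEulerProduct
import HarnessLib

/-!
# Orbital integrals of pure tensors on `U(H)(𝔸_{L⁺,f})` are Euler products of local orbital integrals
(Gelbart (1975) (9.14), p. 155 (10.19); Rogawski (1990) §5.4 p. 72, §14.5 p. 237: `Φ(γ, f) = ∏_v Φ(γ_v, f_v)` for `f = ⊗ f_v`)

Topic `NumberTheory/Automorphic`; namespace `Literature.NumberTheory.Automorphic.UnitaryGroup`. THEOREMS ONLY (no definition,
no instance, no named fact, no `sorry`). The CM specialisation of ★ `OrbitalEulerProductModel` along ★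
`finAdelicEquiv : U(H)(𝔸_{L⁺,f}) ≃ₜ* ∏'_v (U(H)(L⁺_v) : U(H)(𝒪_v))` and the local models ★ `localPiEquiv v`.

For a CM field `L`, `H ∈ M_N(L)`, `g ∈ U(H)(𝔸_{L⁺}) = (cmDatum L N H).Adelic` with finite part `g_f = finPart g ∈ G_f = U(H)(𝔸_{L⁺,f})`
(★ `UnitaryGroup.finAdelic`) and local components `g_v = (cmDatum L N H).toLocal v g` (★ `localPiEquiv_evalPlace_finPart`); ANY
non-zero `G_f`-invariant Borel measure `μ` on `G_f ⧸ G_{f,g_f}` finite on compacta, local invariant Borel measures `m_v` on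
`U(H)(L⁺_v) ⧸ U(H)(L⁺_v)_{g_v}` finite on compacta with `m_v(π_v U(H)(𝒪_v)) = 1` off a finite `S₀` and `m_v ≠ 0` on `S₀`:

* §3 **`exists_orbitalIntegral_finPart_eq_smul_prod`** — ONE `c ≠ 0` with
  `orbitalIntegral g_f F μ = c · ∏_{v∈S₂} localOrbitalIntegral v g_v (f v) m_v` for every finite-adelic pure tensor `F`
  (B13 currency: `F b = ∏_{v∈S} f_v(localPiEquiv v (evalPlace v b))` on the cylinders `{b_v ∈ U(H)(𝒪_v), v ∉ S}`, `S ⊇ S₁`) whose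
  orbital integrand is `μ`-integrable and whose local orbital integrals are `1` off a finite `S₂` (the unramified computation —
  NOT proved here; normalisation ruling R-g2-2); **`exists_tendsto_prod_localOrbitalIntegral_finPart`** — the CONVERGENCE form
  `∏_{v∈T} Φ(g_v, f_v) ⟶ c⁻¹ Φ(g_f, F)` (no unramified computation: the place-by-place comparison form);
* §4 `PureTensor.finFactor_eq_prod_of_forall` (B13's finite-adelic factor `Λ_T` of ★ `PureTensor.eval_eq_arch_mul_finFactor`
  factorises on the cylinders) and the pure-tensor readings **`exists_orbitalIntegral_finPart_finFactor_eq_smul_prod`**,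
  **`exists_tendsto_prod_localOrbitalIntegral_finPart_finFactor`** — the finite factor that the `∞ × f` split
  (★ `UnitaryGroupOrbitalIntegralArchFinSplit`, F0P3a-p04) composes with: `Φ(g, T.eval) = κ · Φ(g_∞, T.arch) · c · ∏_v Φ(g_v, T.loc v)`.

Written for the cell `pub/hodgecm-mathlib`, ENGINE T1 line `F0_T1InnerFormTraceIdentity`, plan O13c-Q3a / PLAN-T1 (g2) O2 (handshake
with F0P3a-p04 (O-I), 2026-08-31). HC_CM is proved only modulo the printed citations until rung 0 closes; this file is unconditional.

## References

* S. Gelbart, *Automorphic forms on adele groups*, Ann. of Math. Stud. 83 (1975), (9.13)–(9.14), p. 155 (10.19) [Gelbart1975].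
* J. D. Rogawski, *Automorphic Representations of Unitary Groups in Three Variables* (1990), §5.4 p. 72, §14.5 p. 237 [Rogawski1990].
* A. Borel, H. Jacquet, *Automorphic forms and automorphic representations*, PSPM 33.1 (1979), §4.1 [BorelJacquet1979].
-/

noncomputable section

open MeasureTheory Measure Set Filter Topology NumberField IsDedekindDomain
open Literature.MeasureTheory.Group Literature.MeasureTheory.RestrictedProduct Literature.Topology.RestrictedProduct
open scoped ENNReal NNReal RestrictedProduct

namespace Literature.NumberTheory.Automorphic

/-! ## §3 The finite-adelic unitary group `U(H)(𝔸_{L⁺,f})`: `Φ(γ, ⊗ f_v) = c · ∏_v Φ(γ_v, f_v)` -/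

namespace UnitaryGroup

variable (L : Type) [Field L] [NumberField L] [IsCMField L] (N : ℕ) (H : Matrix (Fin N) (Fin N) L)

/-- **Euler product of orbital integrals on `U(H)(𝔸_{L⁺,f})` (scalar, stabilised form).** Let `g ∈ U(H)(𝔸_{L⁺})`
(`(cmDatum L N H).Adelic`) with finite part `g_f = finPart g ∈ G_f = U(H)(𝔸_{L⁺,f})` and local components
`g_v = (cmDatum L N H).toLocal v g ∈ U(H)(L⁺_v)` (`= localPiEquiv v (evalPlace v g_f)`, ★ `localPiEquiv_evalPlace_finPart`);
let `μ ≠ 0` be a `G_f`-invariant Borel measure on `G_f ⧸ G_{f,g_f}` finite on compacta, and `m_v` invariant Borel measures on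
the `U(H)(L⁺_v) ⧸ U(H)(L⁺_v)_{g_v}` finite on compacta with `m_v(π_v U(H)(𝒪_v)) = 1` for `v ∉ S₀` and `m_v ≠ 0` for `v ∈ S₀`.
Then there is ONE `c ≠ 0` such that for every finite-adelic pure tensor `F` — `F(b) = ∏_{v∈S} f_v(b_v)`
(`b_v = localPiEquiv v (evalPlace v b)`) whenever `b_v ∈ U(H)(𝒪_v)` off `S`, for all `S ⊇ S₁`, `S₁ ⊇ S₀`
containing the places where `(g_f)_v ∉ U(H)(𝒪_v)` — whose orbital integrand `y ↦ F(y g_f y⁻¹)` is `μ`-integrable and whose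
local orbital integrals `Φ(g_v, f_v) = localOrbitalIntegral v g_v f_v m_v` are `1` off a finite `S₂` (the unramified
computation — NOT proved here): `orbitalIntegral g_f F μ = c · ∏_{v∈S₂} Φ(g_v, f_v)`.
[cite: Gelbart1975, p. 155 (10.19)] [cite: Rogawski1990, §5.4 p. 72] -/
theorem exists_orbitalIntegral_finPart_eq_smul_prod (g : (cmDatum L N H).Adelic)
    [MeasurableSpace (finAdelic (↥(maximalRealSubfield L)) L (IsCMField.complexConj L) N H ⧸ Subgroup.centralizer ({(finPart (↥(maximalRealSubfield L)) L (IsCMField.complexConj L) N H g)} : Set (finAdelic (↥(maximalRealSubfield L)) L (IsCMField.complexConj L) N H)))]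
    [BorelSpace (finAdelic (↥(maximalRealSubfield L)) L (IsCMField.complexConj L) N H ⧸ Subgroup.centralizer ({(finPart (↥(maximalRealSubfield L)) L (IsCMField.complexConj L) N H g)} : Set (finAdelic (↥(maximalRealSubfield L)) L (IsCMField.complexConj L) N H)))]
    (μ : Measure (finAdelic (↥(maximalRealSubfield L)) L (IsCMField.complexConj L) N H ⧸ Subgroup.centralizer ({(finPart (↥(maximalRealSubfield L)) L (IsCMField.complexConj L) N H g)} : Set (finAdelic (↥(maximalRealSubfield L)) L (IsCMField.complexConj L) N H))))
    [SMulInvariantMeasure (finAdelic (↥(maximalRealSubfield L)) L (IsCMField.complexConj L) N H) (finAdelic (↥(maximalRealSubfield L)) L (IsCMField.complexConj L) N H ⧸ Subgroup.centralizer ({(finPart (↥(maximalRealSubfield L)) L (IsCMField.complexConj L) N H g)} : Set (finAdelic (↥(maximalRealSubfield L)) L (IsCMField.complexConj L) N H))) μ]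
    [IsFiniteMeasureOnCompacts μ] (hμ : μ ≠ 0)
    [∀ v, MeasurableSpace ((cmDatum L N H).Local v ⧸ Subgroup.centralizer ({((cmDatum L N H).toLocal v g)} : Set ((cmDatum L N H).Local v)))]
    [∀ v, BorelSpace ((cmDatum L N H).Local v ⧸ Subgroup.centralizer ({((cmDatum L N H).toLocal v g)} : Set ((cmDatum L N H).Local v)))]
    (m : ∀ v, Measure ((cmDatum L N H).Local v ⧸ Subgroup.centralizer ({((cmDatum L N H).toLocal v g)} : Set ((cmDatum L N H).Local v))))
    [∀ v, SMulInvariantMeasure ((cmDatum L N H).Local v)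
      ((cmDatum L N H).Local v ⧸ Subgroup.centralizer ({((cmDatum L N H).toLocal v g)} : Set ((cmDatum L N H).Local v))) (m v)]
    [∀ v, IsFiniteMeasureOnCompacts (m v)]
    {S₀ : Finset (HeightOneSpectrum (𝓞 ↥(maximalRealSubfield L)))}
    (hm1 : ∀ v, v ∉ S₀ → m v ((QuotientGroup.mk : (cmDatum L N H).Local v → _) ''
      (cmLocalIntegralLevel L N H v : Set ((cmDatum L N H).Local v))) = 1)
    (hm : ∀ v, v ∈ S₀ → m v ≠ 0) :
    ∃ c : ℝ≥0, c ≠ 0 ∧ ∀ (f : ∀ v, (cmDatum L N H).Local v → ℂ) (F : finAdelic (↥(maximalRealSubfield L)) L (IsCMField.complexConj L) N H → ℂ)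
      (S₁ S₂ : Finset (HeightOneSpectrum (𝓞 ↥(maximalRealSubfield L)))),
      (∀ S : Finset (HeightOneSpectrum (𝓞 ↥(maximalRealSubfield L))), S₁ ⊆ S → ∀ b : finAdelic (↥(maximalRealSubfield L)) L (IsCMField.complexConj L) N H,
          (∀ v, v ∉ S → evalPlace (↥(maximalRealSubfield L)) L (IsCMField.complexConj L) N H v b ∈ localInt L (IsCMField.complexConj L) N H v) →
          F b = ∏ v ∈ S, f v (localPiEquiv L (IsCMField.complexConj L) N H v (evalPlace (↥(maximalRealSubfield L)) L (IsCMField.complexConj L) N H v b))) →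
      (∀ v, v ∉ S₁ → evalPlace (↥(maximalRealSubfield L)) L (IsCMField.complexConj L) N H v (finPart (↥(maximalRealSubfield L)) L (IsCMField.complexConj L) N H g) ∈ localInt L (IsCMField.complexConj L) N H v) →
      S₀ ⊆ S₁ →
      Integrable (descConj (finPart (↥(maximalRealSubfield L)) L (IsCMField.complexConj L) N H g) (Subgroup.centralizer ({(finPart (↥(maximalRealSubfield L)) L (IsCMField.complexConj L) N H g)} : Set (finAdelic (↥(maximalRealSubfield L)) L (IsCMField.complexConj L) N H))) (centralizer_comm _) F) μ →
      (∀ v, v ∉ S₂ → localOrbitalIntegral L N H v ((cmDatum L N H).toLocal v g) (f v) (m v) = 1) →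
        orbitalIntegral (finPart (↥(maximalRealSubfield L)) L (IsCMField.complexConj L) N H g) F μ = c • ∏ v ∈ S₂, localOrbitalIntegral L N H v ((cmDatum L N H).toLocal v g) (f v) (m v) := by
  haveI : ∀ v, SecondCountableTopology (↥(localPi L (IsCMField.complexConj L) N H v)) := fun v => secondCountableTopology_localPi L N (IsCMField.complexConj L) H v
  haveI : ∀ v, LocallyCompactSpace (↥(localPi L (IsCMField.complexConj L) N H v)) := fun v => locallyCompactSpace_localPi L N (IsCMField.complexConj L) H v
  haveI : ∀ v, CompactSpace ↥(localInt L (IsCMField.complexConj L) N H v) := fun v =>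
    isCompact_iff_compactSpace.1 (isCompact_localInt L (IsCMField.complexConj L) N H v)
  haveI : Countable (HeightOneSpectrum (𝓞 ↥(maximalRealSubfield L))) :=
    countable_heightOneSpectrum ↥(maximalRealSubfield L)
  let ψ' : ∀ v, ↥(localPi L (IsCMField.complexConj L) N H v) ≃ₜ* (cmDatum L N H).Local v := fun v => localPiEquiv L (IsCMField.complexConj L) N H v
  have hγloc : ∀ v, ψ' v (finAdelicEquiv (↥(maximalRealSubfield L)) L (IsCMField.complexConj L) N H (finPart (↥(maximalRealSubfield L)) L (IsCMField.complexConj L) N H g) v) = ((cmDatum L N H).toLocal v g) :=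
    fun v => localPiEquiv_evalPlace_finPart (↥(maximalRealSubfield L)) L (IsCMField.complexConj L) N H v g
  have hm1' : ∀ v, v ∉ S₀ → m v ((QuotientGroup.mk : (cmDatum L N H).Local v → _) ''
      (⇑(ψ' v).symm ⁻¹' (localInt L (IsCMField.complexConj L) N H v : Set ↥(localPi L (IsCMField.complexConj L) N H v)))) = 1 := by
    intro v hv
    have hpre : ⇑(ψ' v).symm ⁻¹' (localInt L (IsCMField.complexConj L) N H v : Set ↥(localPi L (IsCMField.complexConj L) N H v)) =
        (cmLocalIntegralLevel L N H v : Set ((cmDatum L N H).Local v)) :=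
      Set.ext fun x => localPiEquiv_symm_mem_localInt_iff (IsCMField.complexConj L) N H v x
    rw [hpre]
    exact hm1 v hv
  exact exists_orbitalIntegral_eq_smul_prod_of_continuousMulEquiv (fun v => localInt L (IsCMField.complexConj L) N H v)
    (Lc := fun v => (cmDatum L N H).Local v) ψ'
    (finAdelicEquiv (↥(maximalRealSubfield L)) L (IsCMField.complexConj L) N H) (finPart (↥(maximalRealSubfield L)) L (IsCMField.complexConj L) N H g) (fun v => ((cmDatum L N H).toLocal v g)) hγloc μ m hμ hm1' hm

/-- **Euler product of orbital integrals on `U(H)(𝔸_{L⁺,f})`, convergence form** (no unramified computation needed): ONE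
`c ≠ 0` such that for every finite-adelic pure tensor `F` (factorising on the cylinders from `S₁ ⊇ S₀ ∪ S_{g_f}` on) with
`μ`-integrable orbital integrand, `∏_{v∈T} localOrbitalIntegral v g_v (f v) m_v ⟶ c⁻¹ · orbitalIntegral g_f F μ` as `T ↑`
(`atTop` on finite sets of places). [cite: Gelbart1975, p. 155 (10.19)] [cite: Rogawski1990, §5.4 p. 72] -/
theorem exists_tendsto_prod_localOrbitalIntegral_finPart (g : (cmDatum L N H).Adelic)
    [MeasurableSpace (finAdelic (↥(maximalRealSubfield L)) L (IsCMField.complexConj L) N H ⧸ Subgroup.centralizer ({(finPart (↥(maximalRealSubfield L)) L (IsCMField.complexConj L) N H g)} : Set (finAdelic (↥(maximalRealSubfield L)) L (IsCMField.complexConj L) N H)))]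
    [BorelSpace (finAdelic (↥(maximalRealSubfield L)) L (IsCMField.complexConj L) N H ⧸ Subgroup.centralizer ({(finPart (↥(maximalRealSubfield L)) L (IsCMField.complexConj L) N H g)} : Set (finAdelic (↥(maximalRealSubfield L)) L (IsCMField.complexConj L) N H)))]
    (μ : Measure (finAdelic (↥(maximalRealSubfield L)) L (IsCMField.complexConj L) N H ⧸ Subgroup.centralizer ({(finPart (↥(maximalRealSubfield L)) L (IsCMField.complexConj L) N H g)} : Set (finAdelic (↥(maximalRealSubfield L)) L (IsCMField.complexConj L) N H))))
    [SMulInvariantMeasure (finAdelic (↥(maximalRealSubfield L)) L (IsCMField.complexConj L) N H) (finAdelic (↥(maximalRealSubfield L)) L (IsCMField.complexConj L) N H ⧸ Subgroup.centralizer ({(finPart (↥(maximalRealSubfield L)) L (IsCMField.complexConj L) N H g)} : Set (finAdelic (↥(maximalRealSubfield L)) L (IsCMField.complexConj L) N H))) μ]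
    [IsFiniteMeasureOnCompacts μ] (hμ : μ ≠ 0)
    [∀ v, MeasurableSpace ((cmDatum L N H).Local v ⧸ Subgroup.centralizer ({((cmDatum L N H).toLocal v g)} : Set ((cmDatum L N H).Local v)))]
    [∀ v, BorelSpace ((cmDatum L N H).Local v ⧸ Subgroup.centralizer ({((cmDatum L N H).toLocal v g)} : Set ((cmDatum L N H).Local v)))]
    (m : ∀ v, Measure ((cmDatum L N H).Local v ⧸ Subgroup.centralizer ({((cmDatum L N H).toLocal v g)} : Set ((cmDatum L N H).Local v))))
    [∀ v, SMulInvariantMeasure ((cmDatum L N H).Local v)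
      ((cmDatum L N H).Local v ⧸ Subgroup.centralizer ({((cmDatum L N H).toLocal v g)} : Set ((cmDatum L N H).Local v))) (m v)]
    [∀ v, IsFiniteMeasureOnCompacts (m v)]
    {S₀ : Finset (HeightOneSpectrum (𝓞 ↥(maximalRealSubfield L)))}
    (hm1 : ∀ v, v ∉ S₀ → m v ((QuotientGroup.mk : (cmDatum L N H).Local v → _) ''
      (cmLocalIntegralLevel L N H v : Set ((cmDatum L N H).Local v))) = 1)
    (hm : ∀ v, v ∈ S₀ → m v ≠ 0) :
    ∃ c : ℝ≥0, c ≠ 0 ∧ ∀ (f : ∀ v, (cmDatum L N H).Local v → ℂ) (F : finAdelic (↥(maximalRealSubfield L)) L (IsCMField.complexConj L) N H → ℂ)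
      (S₁ : Finset (HeightOneSpectrum (𝓞 ↥(maximalRealSubfield L)))),
      (∀ S : Finset (HeightOneSpectrum (𝓞 ↥(maximalRealSubfield L))), S₁ ⊆ S → ∀ b : finAdelic (↥(maximalRealSubfield L)) L (IsCMField.complexConj L) N H,
          (∀ v, v ∉ S → evalPlace (↥(maximalRealSubfield L)) L (IsCMField.complexConj L) N H v b ∈ localInt L (IsCMField.complexConj L) N H v) →
          F b = ∏ v ∈ S, f v (localPiEquiv L (IsCMField.complexConj L) N H v (evalPlace (↥(maximalRealSubfield L)) L (IsCMField.complexConj L) N H v b))) →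
      (∀ v, v ∉ S₁ → evalPlace (↥(maximalRealSubfield L)) L (IsCMField.complexConj L) N H v (finPart (↥(maximalRealSubfield L)) L (IsCMField.complexConj L) N H g) ∈ localInt L (IsCMField.complexConj L) N H v) →
      S₀ ⊆ S₁ →
      Integrable (descConj (finPart (↥(maximalRealSubfield L)) L (IsCMField.complexConj L) N H g) (Subgroup.centralizer ({(finPart (↥(maximalRealSubfield L)) L (IsCMField.complexConj L) N H g)} : Set (finAdelic (↥(maximalRealSubfield L)) L (IsCMField.complexConj L) N H))) (centralizer_comm _) F) μ →
        Tendsto (fun T : Finset (HeightOneSpectrum (𝓞 ↥(maximalRealSubfield L))) =>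
            ∏ v ∈ T, localOrbitalIntegral L N H v ((cmDatum L N H).toLocal v g) (f v) (m v)) atTop
          (𝓝 (((c : ℝ)⁻¹) • orbitalIntegral (finPart (↥(maximalRealSubfield L)) L (IsCMField.complexConj L) N H g) F μ)) := by
  haveI : ∀ v, SecondCountableTopology (↥(localPi L (IsCMField.complexConj L) N H v)) := fun v => secondCountableTopology_localPi L N (IsCMField.complexConj L) H v
  haveI : ∀ v, LocallyCompactSpace (↥(localPi L (IsCMField.complexConj L) N H v)) := fun v => locallyCompactSpace_localPi L N (IsCMField.complexConj L) H v
  haveI : ∀ v, CompactSpace ↥(localInt L (IsCMField.complexConj L) N H v) := fun v =>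
    isCompact_iff_compactSpace.1 (isCompact_localInt L (IsCMField.complexConj L) N H v)
  haveI : Countable (HeightOneSpectrum (𝓞 ↥(maximalRealSubfield L))) :=
    countable_heightOneSpectrum ↥(maximalRealSubfield L)
  let ψ' : ∀ v, ↥(localPi L (IsCMField.complexConj L) N H v) ≃ₜ* (cmDatum L N H).Local v := fun v => localPiEquiv L (IsCMField.complexConj L) N H v
  have hγloc : ∀ v, ψ' v (finAdelicEquiv (↥(maximalRealSubfield L)) L (IsCMField.complexConj L) N H (finPart (↥(maximalRealSubfield L)) L (IsCMField.complexConj L) N H g) v) = ((cmDatum L N H).toLocal v g) :=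
    fun v => localPiEquiv_evalPlace_finPart (↥(maximalRealSubfield L)) L (IsCMField.complexConj L) N H v g
  have hm1' : ∀ v, v ∉ S₀ → m v ((QuotientGroup.mk : (cmDatum L N H).Local v → _) ''
      (⇑(ψ' v).symm ⁻¹' (localInt L (IsCMField.complexConj L) N H v : Set ↥(localPi L (IsCMField.complexConj L) N H v)))) = 1 := by
    intro v hv
    have hpre : ⇑(ψ' v).symm ⁻¹' (localInt L (IsCMField.complexConj L) N H v : Set ↥(localPi L (IsCMField.complexConj L) N H v)) =
        (cmLocalIntegralLevel L N H v : Set ((cmDatum L N H).Local v)) :=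
      Set.ext fun x => localPiEquiv_symm_mem_localInt_iff (IsCMField.complexConj L) N H v x
    rw [hpre]
    exact hm1 v hv
  exact exists_tendsto_prod_orbitalIntegral_of_continuousMulEquiv (fun v => localInt L (IsCMField.complexConj L) N H v)
    (Lc := fun v => (cmDatum L N H).Local v) ψ'
    (finAdelicEquiv (↥(maximalRealSubfield L)) L (IsCMField.complexConj L) N H) (finPart (↥(maximalRealSubfield L)) L (IsCMField.complexConj L) N H g) (fun v => ((cmDatum L N H).toLocal v g)) hγloc μ m hμ hm1' hm

/-! ## §4 The finite-adelic factor `Λ_T` of a pure tensor (B13's currency) -/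

variable {L N H} in
/-- **The finite-adelic factor of a pure tensor factorises on the cylinders.** For a pure tensor `T` with integral levels
off its bad set (`T.K v = U(H)(𝒪_v)`, `v ∉ T.S`) and `S ⊇ T.S`: if `b_v ∈ U(H)(𝒪_v)` for `v ∉ S`, then
`Λ_T(b) = 1_{∀ v ∉ T.S, b_v ∈ U(H)(𝒪_v)}(b) · ∏_{v∈T.S} f_v(b_v) = ∏_{v∈S} f_v(b_v)` — the unramified factors
`f_v = 1_{U(H)(𝒪_v)}`, `v ∈ S ∖ T.S`, reproduce the indicator (`Λ_T` as in ★ `PureTensor.eval_eq_arch_mul_finFactor`).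
[cite: BorelJacquet1979, §4.1] [cite: Rogawski1990, §14.2 p. 233] -/
theorem PureTensor.finFactor_eq_prod_of_forall (T : PureTensor L N H)
    (hK : ∀ v ∉ T.S, T.K v = cmLocalIntegralLevel L N H v)
    (S : Finset (HeightOneSpectrum (𝓞 ↥(maximalRealSubfield L)))) (hS : T.S ⊆ S) (b : finAdelic (↥(maximalRealSubfield L)) L (IsCMField.complexConj L) N H)
    (hb : ∀ v, v ∉ S → evalPlace (↥(maximalRealSubfield L)) L (IsCMField.complexConj L) N H v b ∈ localInt L (IsCMField.complexConj L) N H v) :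
    {b : finAdelic (↥(maximalRealSubfield L)) L (IsCMField.complexConj L) N H | ∀ v ∉ T.S, evalPlace (↥(maximalRealSubfield L)) L (IsCMField.complexConj L) N H v b ∈ localInt L (IsCMField.complexConj L) N H v}.indicator
      (fun b => ∏ v ∈ T.S, T.loc v (localPiEquiv L (IsCMField.complexConj L) N H v (evalPlace (↥(maximalRealSubfield L)) L (IsCMField.complexConj L) N H v b))) b =
      ∏ v ∈ S, T.loc v (localPiEquiv L (IsCMField.complexConj L) N H v (evalPlace (↥(maximalRealSubfield L)) L (IsCMField.complexConj L) N H v b)) := by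
  classical
  -- the unramified factors: `f_v(b_v) = 1` if `b_v ∈ U(H)(𝒪_v)`, `= 0` if not (`v ∉ T.S`)
  have hone : ∀ v, v ∉ T.S → evalPlace (↥(maximalRealSubfield L)) L (IsCMField.complexConj L) N H v b ∈ localInt L (IsCMField.complexConj L) N H v →
      T.loc v (localPiEquiv L (IsCMField.complexConj L) N H v (evalPlace (↥(maximalRealSubfield L)) L (IsCMField.complexConj L) N H v b)) = 1 := by
    intro v hv hmem
    rw [T.loc_eq_indicator v hv, hK v hv]
    exact Set.indicator_of_mem ((localPiEquiv_mem_localIntegralLevel_iff (IsCMField.complexConj L) N H v _).2 hmem) _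
  have hzero : ∀ v, v ∉ T.S → evalPlace (↥(maximalRealSubfield L)) L (IsCMField.complexConj L) N H v b ∉ localInt L (IsCMField.complexConj L) N H v →
      T.loc v (localPiEquiv L (IsCMField.complexConj L) N H v (evalPlace (↥(maximalRealSubfield L)) L (IsCMField.complexConj L) N H v b)) = 0 := by
    intro v hv hmem
    rw [T.loc_eq_indicator v hv, hK v hv]
    exact Set.indicator_of_notMem (fun h => hmem ((localPiEquiv_mem_localIntegralLevel_iff (IsCMField.complexConj L) N H v _).1 h)) _
  have hsplit : ∏ v ∈ S, T.loc v (localPiEquiv L (IsCMField.complexConj L) N H v (evalPlace (↥(maximalRealSubfield L)) L (IsCMField.complexConj L) N H v b)) =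
      (∏ v ∈ S \ T.S, T.loc v (localPiEquiv L (IsCMField.complexConj L) N H v (evalPlace (↥(maximalRealSubfield L)) L (IsCMField.complexConj L) N H v b))) *
        ∏ v ∈ T.S, T.loc v (localPiEquiv L (IsCMField.complexConj L) N H v (evalPlace (↥(maximalRealSubfield L)) L (IsCMField.complexConj L) N H v b)) :=
    (Finset.prod_sdiff hS).symm
  by_cases hmem : b ∈ {b : finAdelic (↥(maximalRealSubfield L)) L (IsCMField.complexConj L) N H | ∀ v ∉ T.S, evalPlace (↥(maximalRealSubfield L)) L (IsCMField.complexConj L) N H v b ∈ localInt L (IsCMField.complexConj L) N H v}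
  · have h1 : ∏ v ∈ S \ T.S, T.loc v (localPiEquiv L (IsCMField.complexConj L) N H v (evalPlace (↥(maximalRealSubfield L)) L (IsCMField.complexConj L) N H v b)) = 1 :=
      Finset.prod_eq_one fun v hv => hone v (Finset.mem_sdiff.1 hv).2 (hmem v (Finset.mem_sdiff.1 hv).2)
    refine (Set.indicator_of_mem hmem _).trans ?_
    rw [hsplit, h1, one_mul]
  · have hmem' : ∃ v, v ∉ T.S ∧ evalPlace (↥(maximalRealSubfield L)) L (IsCMField.complexConj L) N H v b ∉ localInt L (IsCMField.complexConj L) N H v := by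
      by_contra hcon
      exact hmem fun v hv => by_contra fun hvK => hcon ⟨v, hv, hvK⟩
    obtain ⟨v, hvT, hvK⟩ := hmem'
    have hvS : v ∈ S := by
      by_contra h
      exact hvK (hb v h)
    have h0 : ∏ v ∈ S \ T.S, T.loc v (localPiEquiv L (IsCMField.complexConj L) N H v (evalPlace (↥(maximalRealSubfield L)) L (IsCMField.complexConj L) N H v b)) = 0 :=
      Finset.prod_eq_zero (Finset.mem_sdiff.2 ⟨hvS, hvT⟩) (hzero v hvT hvK)
    refine (Set.indicator_of_notMem hmem _).trans ?_
    rw [hsplit, h0, zero_mul]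

/-- **Euler product of the finite-adelic orbital integral of a PURE TENSOR** (the form the `∞ × f` split ★
`UnitaryGroupOrbitalIntegralArchFinSplit` composes with): under the hypotheses of
`exists_orbitalIntegral_finPart_eq_smul_prod`, ONE `c ≠ 0` such that for every pure tensor `T` with integral levels off its bad
set, whose finite-adelic factor `Λ_T` (as in ★ `PureTensor.eval_eq_arch_mul_finFactor`) has a `μ`-integrable orbital integrand at
`g_f` and whose local orbital integrals `Φ(g_v, f_v)` are `1` off a finite `S₂`:
`orbitalIntegral g_f Λ_T μ = c · ∏_{v∈S₂} localOrbitalIntegral v g_v (T.loc v) m_v`. [cite: Gelbart1975, p. 155 (10.19)]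
[cite: Rogawski1990, §5.4 p. 72] -/
theorem exists_orbitalIntegral_finPart_finFactor_eq_smul_prod (g : (cmDatum L N H).Adelic)
    [MeasurableSpace (finAdelic (↥(maximalRealSubfield L)) L (IsCMField.complexConj L) N H ⧸ Subgroup.centralizer ({(finPart (↥(maximalRealSubfield L)) L (IsCMField.complexConj L) N H g)} : Set (finAdelic (↥(maximalRealSubfield L)) L (IsCMField.complexConj L) N H)))]
    [BorelSpace (finAdelic (↥(maximalRealSubfield L)) L (IsCMField.complexConj L) N H ⧸ Subgroup.centralizer ({(finPart (↥(maximalRealSubfield L)) L (IsCMField.complexConj L) N H g)} : Set (finAdelic (↥(maximalRealSubfield L)) L (IsCMField.complexConj L) N H)))]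
    (μ : Measure (finAdelic (↥(maximalRealSubfield L)) L (IsCMField.complexConj L) N H ⧸ Subgroup.centralizer ({(finPart (↥(maximalRealSubfield L)) L (IsCMField.complexConj L) N H g)} : Set (finAdelic (↥(maximalRealSubfield L)) L (IsCMField.complexConj L) N H))))
    [SMulInvariantMeasure (finAdelic (↥(maximalRealSubfield L)) L (IsCMField.complexConj L) N H) (finAdelic (↥(maximalRealSubfield L)) L (IsCMField.complexConj L) N H ⧸ Subgroup.centralizer ({(finPart (↥(maximalRealSubfield L)) L (IsCMField.complexConj L) N H g)} : Set (finAdelic (↥(maximalRealSubfield L)) L (IsCMField.complexConj L) N H))) μ]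
    [IsFiniteMeasureOnCompacts μ] (hμ : μ ≠ 0)
    [∀ v, MeasurableSpace ((cmDatum L N H).Local v ⧸ Subgroup.centralizer ({((cmDatum L N H).toLocal v g)} : Set ((cmDatum L N H).Local v)))]
    [∀ v, BorelSpace ((cmDatum L N H).Local v ⧸ Subgroup.centralizer ({((cmDatum L N H).toLocal v g)} : Set ((cmDatum L N H).Local v)))]
    (m : ∀ v, Measure ((cmDatum L N H).Local v ⧸ Subgroup.centralizer ({((cmDatum L N H).toLocal v g)} : Set ((cmDatum L N H).Local v))))
    [∀ v, SMulInvariantMeasure ((cmDatum L N H).Local v)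
      ((cmDatum L N H).Local v ⧸ Subgroup.centralizer ({((cmDatum L N H).toLocal v g)} : Set ((cmDatum L N H).Local v))) (m v)]
    [∀ v, IsFiniteMeasureOnCompacts (m v)]
    {S₀ : Finset (HeightOneSpectrum (𝓞 ↥(maximalRealSubfield L)))}
    (hm1 : ∀ v, v ∉ S₀ → m v ((QuotientGroup.mk : (cmDatum L N H).Local v → _) ''
      (cmLocalIntegralLevel L N H v : Set ((cmDatum L N H).Local v))) = 1)
    (hm : ∀ v, v ∈ S₀ → m v ≠ 0) :
    ∃ c : ℝ≥0, c ≠ 0 ∧ ∀ (T : PureTensor L N H) (S₂ : Finset (HeightOneSpectrum (𝓞 ↥(maximalRealSubfield L)))),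
      (∀ v ∉ T.S, T.K v = cmLocalIntegralLevel L N H v) →
      Integrable (descConj (finPart (↥(maximalRealSubfield L)) L (IsCMField.complexConj L) N H g) (Subgroup.centralizer ({(finPart (↥(maximalRealSubfield L)) L (IsCMField.complexConj L) N H g)} : Set (finAdelic (↥(maximalRealSubfield L)) L (IsCMField.complexConj L) N H))) (centralizer_comm _)
        ({b : finAdelic (↥(maximalRealSubfield L)) L (IsCMField.complexConj L) N H |
            ∀ v ∉ T.S, evalPlace (↥(maximalRealSubfield L)) L (IsCMField.complexConj L) N H v b ∈ localInt L (IsCMField.complexConj L) N H v}.indicator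
          (fun b => ∏ v ∈ T.S, T.loc v (localPiEquiv L (IsCMField.complexConj L) N H v (evalPlace (↥(maximalRealSubfield L)) L (IsCMField.complexConj L) N H v b))))) μ →
      (∀ v, v ∉ S₂ → localOrbitalIntegral L N H v ((cmDatum L N H).toLocal v g) (T.loc v) (m v) = 1) →
        orbitalIntegral (finPart (↥(maximalRealSubfield L)) L (IsCMField.complexConj L) N H g)
          ({b : finAdelic (↥(maximalRealSubfield L)) L (IsCMField.complexConj L) N H |
            ∀ v ∉ T.S, evalPlace (↥(maximalRealSubfield L)) L (IsCMField.complexConj L) N H v b ∈ localInt L (IsCMField.complexConj L) N H v}.indicator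
          (fun b => ∏ v ∈ T.S, T.loc v (localPiEquiv L (IsCMField.complexConj L) N H v (evalPlace (↥(maximalRealSubfield L)) L (IsCMField.complexConj L) N H v b)))) μ =
          c • ∏ v ∈ S₂, localOrbitalIntegral L N H v ((cmDatum L N H).toLocal v g) (T.loc v) (m v) := by
  classical
  obtain ⟨c, hc0, hc⟩ := exists_orbitalIntegral_finPart_eq_smul_prod L N H g μ hμ m hm1 hm
  refine ⟨c, hc0, fun T S₂ hK hFi hf1 => ?_⟩
  obtain ⟨Sg, hSg⟩ := Literature.MeasureTheory.RestrictedProduct.exists_finset_forall_not_mem_apply_mem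
    (fun v => localInt L (IsCMField.complexConj L) N H v) (finAdelicEquiv (↥(maximalRealSubfield L)) L (IsCMField.complexConj L) N H (finPart (↥(maximalRealSubfield L)) L (IsCMField.complexConj L) N H g))
  exact hc T.loc _ (T.S ∪ S₀ ∪ Sg) S₂
    (fun S hS b hb => PureTensor.finFactor_eq_prod_of_forall T hK S
      ((Finset.subset_union_left.trans Finset.subset_union_left).trans hS) b hb)
    (fun v hv => hSg v fun h => hv (Finset.mem_union_right _ h))
    (Finset.subset_union_right.trans Finset.subset_union_left) hFi hf1

/-- **Convergence form for the finite-adelic factor `Λ_T` of a PURE TENSOR**: ONE `c ≠ 0` such that for every pure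
tensor `T` with integral levels off its bad set whose `Λ_T` has a `μ`-integrable orbital integrand at `g_f`,
`∏_{v∈U} localOrbitalIntegral v g_v (T.loc v) m_v ⟶ c⁻¹ · orbitalIntegral g_f Λ_T μ` as `U ↑` — the place-by-place comparison
form (no unramified computation). [cite: Gelbart1975, p. 155 (10.19)] [cite: Rogawski1990, §5.4 p. 72] -/
theorem exists_tendsto_prod_localOrbitalIntegral_finPart_finFactor (g : (cmDatum L N H).Adelic)
    [MeasurableSpace (finAdelic (↥(maximalRealSubfield L)) L (IsCMField.complexConj L) N H ⧸ Subgroup.centralizer ({(finPart (↥(maximalRealSubfield L)) L (IsCMField.complexConj L) N H g)} : Set (finAdelic (↥(maximalRealSubfield L)) L (IsCMField.complexConj L) N H)))]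
    [BorelSpace (finAdelic (↥(maximalRealSubfield L)) L (IsCMField.complexConj L) N H ⧸ Subgroup.centralizer ({(finPart (↥(maximalRealSubfield L)) L (IsCMField.complexConj L) N H g)} : Set (finAdelic (↥(maximalRealSubfield L)) L (IsCMField.complexConj L) N H)))]
    (μ : Measure (finAdelic (↥(maximalRealSubfield L)) L (IsCMField.complexConj L) N H ⧸ Subgroup.centralizer ({(finPart (↥(maximalRealSubfield L)) L (IsCMField.complexConj L) N H g)} : Set (finAdelic (↥(maximalRealSubfield L)) L (IsCMField.complexConj L) N H))))
    [SMulInvariantMeasure (finAdelic (↥(maximalRealSubfield L)) L (IsCMField.complexConj L) N H) (finAdelic (↥(maximalRealSubfield L)) L (IsCMField.complexConj L) N H ⧸ Subgroup.centralizer ({(finPart (↥(maximalRealSubfield L)) L (IsCMField.complexConj L) N H g)} : Set (finAdelic (↥(maximalRealSubfield L)) L (IsCMField.complexConj L) N H))) μ]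
    [IsFiniteMeasureOnCompacts μ] (hμ : μ ≠ 0)
    [∀ v, MeasurableSpace ((cmDatum L N H).Local v ⧸ Subgroup.centralizer ({((cmDatum L N H).toLocal v g)} : Set ((cmDatum L N H).Local v)))]
    [∀ v, BorelSpace ((cmDatum L N H).Local v ⧸ Subgroup.centralizer ({((cmDatum L N H).toLocal v g)} : Set ((cmDatum L N H).Local v)))]
    (m : ∀ v, Measure ((cmDatum L N H).Local v ⧸ Subgroup.centralizer ({((cmDatum L N H).toLocal v g)} : Set ((cmDatum L N H).Local v))))
    [∀ v, SMulInvariantMeasure ((cmDatum L N H).Local v)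
      ((cmDatum L N H).Local v ⧸ Subgroup.centralizer ({((cmDatum L N H).toLocal v g)} : Set ((cmDatum L N H).Local v))) (m v)]
    [∀ v, IsFiniteMeasureOnCompacts (m v)]
    {S₀ : Finset (HeightOneSpectrum (𝓞 ↥(maximalRealSubfield L)))}
    (hm1 : ∀ v, v ∉ S₀ → m v ((QuotientGroup.mk : (cmDatum L N H).Local v → _) ''
      (cmLocalIntegralLevel L N H v : Set ((cmDatum L N H).Local v))) = 1)
    (hm : ∀ v, v ∈ S₀ → m v ≠ 0) :
    ∃ c : ℝ≥0, c ≠ 0 ∧ ∀ (T : PureTensor L N H),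
      (∀ v ∉ T.S, T.K v = cmLocalIntegralLevel L N H v) →
      Integrable (descConj (finPart (↥(maximalRealSubfield L)) L (IsCMField.complexConj L) N H g) (Subgroup.centralizer ({(finPart (↥(maximalRealSubfield L)) L (IsCMField.complexConj L) N H g)} : Set (finAdelic (↥(maximalRealSubfield L)) L (IsCMField.complexConj L) N H))) (centralizer_comm _)
        ({b : finAdelic (↥(maximalRealSubfield L)) L (IsCMField.complexConj L) N H |
            ∀ v ∉ T.S, evalPlace (↥(maximalRealSubfield L)) L (IsCMField.complexConj L) N H v b ∈ localInt L (IsCMField.complexConj L) N H v}.indicator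
          (fun b => ∏ v ∈ T.S, T.loc v (localPiEquiv L (IsCMField.complexConj L) N H v (evalPlace (↥(maximalRealSubfield L)) L (IsCMField.complexConj L) N H v b))))) μ →
        Tendsto (fun U : Finset (HeightOneSpectrum (𝓞 ↥(maximalRealSubfield L))) =>
            ∏ v ∈ U, localOrbitalIntegral L N H v ((cmDatum L N H).toLocal v g) (T.loc v) (m v)) atTop
          (𝓝 (((c : ℝ)⁻¹) • orbitalIntegral (finPart (↥(maximalRealSubfield L)) L (IsCMField.complexConj L) N H g)
            ({b : finAdelic (↥(maximalRealSubfield L)) L (IsCMField.complexConj L) N H |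
            ∀ v ∉ T.S, evalPlace (↥(maximalRealSubfield L)) L (IsCMField.complexConj L) N H v b ∈ localInt L (IsCMField.complexConj L) N H v}.indicator
          (fun b => ∏ v ∈ T.S, T.loc v (localPiEquiv L (IsCMField.complexConj L) N H v (evalPlace (↥(maximalRealSubfield L)) L (IsCMField.complexConj L) N H v b)))) μ)) := by
  classical
  obtain ⟨c, hc0, hc⟩ := exists_tendsto_prod_localOrbitalIntegral_finPart L N H g μ hμ m hm1 hm
  refine ⟨c, hc0, fun T hK hFi => ?_⟩
  obtain ⟨Sg, hSg⟩ := Literature.MeasureTheory.RestrictedProduct.exists_finset_forall_not_mem_apply_mem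
    (fun v => localInt L (IsCMField.complexConj L) N H v) (finAdelicEquiv (↥(maximalRealSubfield L)) L (IsCMField.complexConj L) N H (finPart (↥(maximalRealSubfield L)) L (IsCMField.complexConj L) N H g))
  exact hc T.loc _ (T.S ∪ S₀ ∪ Sg)
    (fun S hS b hb => PureTensor.finFactor_eq_prod_of_forall T hK S
      ((Finset.subset_union_left.trans Finset.subset_union_left).trans hS) b hb)
    (fun v hv => hSg v fun h => hv (Finset.mem_union_right _ h))
    (Finset.subset_union_right.trans Finset.subset_union_left) hFi

end UnitaryGroup

end Literature.NumberTheory.Automorphic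

end
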